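import Literature.AnabelianGeometry.EtaleTheta.FrobenioidMonoTheta
import Literature.AnabelianGeometry.EtaleTheta.Discharge.Sec5UnitsTransport

/-!
# [EtTh] §5, Theorem 5.10 (i) discharged modulo its cited inputs (p. 334 / PDF p. 108)

Mochizuki, *The étale theta function …*, Publ. RIMS **45** (2009)
[cite: MochizukiEtTh2009, Thm 5.10 (i) p.333 (PDF p.107)].  Seat abc-iut-L2-d4 (wave-3 discharge of node
`EtTh:Thm5.10(i)`); PROOF-ONLY, over abc-iut-L2-t4's `FrobenioidMonoTheta.lean` (`PreservesIsoClasses`) and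
the tree's `Frobenioids.PreFrobenioidData` vocabulary (`IsFrobeniusTrivial`, `IsPreStep`, `div`,
`BaseIsomorphic`, `PreservesObj`, `PreservesMor`).

Theorem 5.10 (i) (p.333 (PDF p.107)): "The self-equivalence `Ψ : C ⥲ C` preserves the isomorphism classes of `A_N`,
`B_N`."  Printed proof (p.334 (PDF p.108)): "Since `Ψ` preserves Frobenius-trivial objects [cf. the proof of
Theorem 4.4], to show that `Ψ` preserves the isomorphism class of `A_N`, it suffices to show that the
equivalence `Ψ^bs : D ⥲ D` [cf. Theorem 4.4] induced by `Ψ` preserves the isomorphism class of the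
objects of `D` determined by '`Z̈_{l·N}`', '`Ÿ`'; but this follows immediately … from Proposition 2.4.
Now the fact that `Ψ` preserves the isomorphism class of `B_N` follows immediately from Proposition 5.3,
(vi)."  The inputs are taken as named hypotheses, each in the shape print gives it: `A_N` is
Frobenius-trivial (p.329 (PDF p.103): the domain "`S₁`" of an `N`-th root "is Frobenius-trivial"); `Ψ` preserves
Frobenius-trivial objects and pre-steps ([FrdI] Thm. 3.4 via Prop. 5.1 — "cf. the proof of Theorem 4.4");
`Ψ(A_N)^bs ≅ A_N^bs` (Prop. 2.4 with the 1-compatibility of `Ψ^bs`); two Frobenius-trivial objects over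
isomorphic bases are isomorphic ([FrdI] Thm. 5.1 (iii), as used on p.329 (PDF p.103): "`T₁` is Frobenius-trivial,
hence isomorphic to `S₁`"); the codomain of a pre-step is determined up to isomorphism by its domain and
zero divisor ("the equivalences of categories involving pre-steps of [FrdI], Definition 1.3, (iii), (d)",
p.329 (PDF p.103)); and the zero divisor of `s^⊓_N` is preserved by `Ψ` up to `Aut_C(A_N)` (Prop. 5.3 (vi):
"the `Aut_C(A_⊚)`-orbit of the divisor of zeroes and poles … of the theta function" is preserved; Cor. 3.8
(iii)).  HONEST FRAMING: a kernel-checked implication between typed statements about the §5 data;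
typed ≠ discharged; no side taken on anything downstream. -/

namespace Literature.AnabelianGeometry.EtaleTheta

open CategoryTheory
open Literature.AlgebraicGeometry.Frobenioids

universe w v v' u u'

namespace ThetaFrobenioid

variable {C : Type u} [Category.{v} C] {D : Type u'} [Category.{v'} D] {𝔉 : ThetaFrobenioid.{w} C D}

/-- **[EtTh] Theorem 5.10 (i), discharged modulo its cited inputs** (see the module docstring for the
correspondence hypothesis ↔ citation): `Ψ(A_N) ≅ A_N` from Frobenius-triviality and the base, `Ψ(B_N) ≅ B_N`
from the transport of the pre-step `s^⊓_N` and of its zero divisor.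
[cite: MochizukiEtTh2009, Thm 5.10 (i) p.333–334 (PDF pp.107–108)] -/
theorem preservesIsoClasses_of (Ψ : C ≌ C)
    (hFT : 𝔉.IsFrobeniusTrivial 𝔉.AN)
    (hΨFT : PreFrobenioidData.PreservesObj Ψ.functor 𝔉.pre.IsFrobeniusTrivial 𝔉.pre.IsFrobeniusTrivial)
    (hbs : 𝔉.pre.BaseIsomorphic (Ψ.functor.obj 𝔉.AN) 𝔉.AN)
    (h51 : ∀ S T : C, 𝔉.IsFrobeniusTrivial S → 𝔉.IsFrobeniusTrivial T → 𝔉.pre.BaseIsomorphic S T →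
      Nonempty (S ≅ T))
    (hΨpre : PreFrobenioidData.PreservesMor Ψ.functor 𝔉.IsPreStep 𝔉.IsPreStep)
    (hdet : ∀ {A B B' : C} (φ : A ⟶ B) (φ' : A ⟶ B'), 𝔉.IsPreStep φ → 𝔉.IsPreStep φ' →
      𝔉.pre.div φ = 𝔉.pre.div φ' → Nonempty (B ≅ B'))
    (hdiv : ∀ α : Ψ.functor.obj 𝔉.AN ≅ 𝔉.AN, ∃ ε : Aut 𝔉.AN,
      𝔉.pre.div (α.inv ≫ Ψ.functor.map 𝔉.sCap) = 𝔉.pre.div (ε.hom ≫ 𝔉.sCap)) :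
    𝔉.PreservesIsoClasses Ψ := by
  obtain ⟨α⟩ := h51 _ _ (hΨFT hFT) hFT hbs
  refine ⟨⟨α⟩, ?_⟩
  obtain ⟨ε, hε⟩ := hdiv α
  obtain ⟨i⟩ := hdet (α.inv ≫ Ψ.functor.map 𝔉.sCap) (ε.hom ≫ 𝔉.sCap)
    (isPreStep_iso_hom_comp α.symm (hΨpre 𝔉.sCap 𝔉.isPreStep_sCap))
    (isPreStep_iso_hom_comp ε 𝔉.isPreStep_sCap) hε
  exact ⟨i⟩

end ThetaFrobenioid

end Literature.AnabelianGeometry.EtaleTheta
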